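import Summits.Ventures.PercRepro.RankLevelSetDepCountGen
import Summits.Ventures.PercRepro.RankLevelSetLevelFive
import Summits.Ventures.PercRepro.RankLevelSetDepCountGiantB2
import Summits.Ventures.PercRepro.RankLevelSetLevelFiveArithThreeA
import Summits.Ventures.PercRepro.RankLevelSetLevelFiveArithThreeB
import Summits.Ventures.PercRepro.RankLevelSetLevelFiveArithThreeC
import Summits.Ventures.PercRepro.RankLevelSetLevelFiveGiant
import Summits.Ventures.PercRepro.RankLevelSetLevelSplitAll
import Summits.Ventures.PercRepro.S1LevelFour
import Summits.Ventures.PercRepro.S1TriangleCount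
import Summits.Ventures.PercRepro.S1FourCircuitCount
import Summits.Ventures.PercRepro.RankLevelSetPlaneTenPrime
import Summits.Ventures.PercRepro.RankLevelSetCoreFiveNineteen
import Summits.Ventures.PercRepro.RankLevelSetCorankFiveCounts
import Summits.Ventures.PercRepro.S2FiveWindow
import Summits.Ventures.PercRepro.S2FlatTail
import Summits.Ventures.PercRepro.S2FlatTailBounds
import Summits.Ventures.PercRepro.S2FlatTailBounds16
import Summits.Ventures.PercRepro.S2TailThreeD
import Summits.Ventures.PercRepro.S2CellsII3C
import Summits.Ventures.PercRepro.RankLevelSetCoreFiveTwentyNine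
import Summits.Ventures.PercRepro.S2SquareGiantCount3D
import Summits.Ventures.PercRepro.S2ThreeAux
import Summits.Ventures.PercRepro.RankLevelSetLevelFiveMult
import Summits.Ventures.PercRepro.RankLevelSetLevelFiveThree
import Summits.Ventures.PercRepro.S2Cells29
import Summits.Ventures.PercRepro.S2Tail29

/-!
# PercRepro — THEOREM C₅ AT `30`: THE «31» MACHINERY AT `p = 29` WITH A FREE SLACK (p7, gen 2; sub-claim S2)

The «31» chain (RankLevelSetLevelFiveThree) closes every cell `(p, d)`, `p ≥ 30`, `6 ≤ d ≤ 25`, with the rigid budget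
split `15/16` (polynomial side) `: 1/16` (`Y`-side tail). At `p = 29` the rigid split fails at the mid coranks `18, 19`
(the spanning tail `Σ_{j ≤ d} C(29 + d, j)` exceeds `2^n/16`) and at `d = 6, 8` (the polynomial side exceeds `15/16`),
while a FREE split `(1024 − m_d)/1024 : m_d/1024` with `m_d = ⌈1024·T/2^n⌉` closes all twenty cells `(29, d)` — pure
arithmetic, no new matroid theory (S2Cells29 / S2Tail29, `level_arith_slack`). Hence:

* **`c025_core_five_bounded_corank_three29`** — the `e`-free core at level `5`, corank `6 ≤ d ≤ 25`, rank `p = 29`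
  (the matroid part of `c025_core_five_bounded_corank_three`, verbatim; the cells by `cells29`);
* **`c025_five_of_four_three_from29`** — for `P ≥ 29`, level `4` for all `p ≥ P` implies level `5` for all `p ≥ P + 1`;
* **`c025_five_large_three30`** — UNCONDITIONAL over the landed tree: C-025 at level `5` for every `p ≥ 30` (level `4`
  from S1's `c025_four_twentyseven`, `p ≥ 27`); `c025_five_large_three30'` is the `C025` spelling.
Axioms: standard.
-/

open scoped Matroid

namespace PercRepro

namespace S2

/-- **The `p = 29` cells, dispatched**: for every corank `6 ≤ d ≤ 25` some slack `m ≤ 1024` with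
`1024·U(29, d) ≤ (1024 − m)·2^(d−5)·C(34, 5)` and `1024·T(29 + d, d) ≤ m·2^(29+d)`. -/
theorem cells29 (d : ℕ) (hd6 : 6 ≤ d) (hd25 : d ≤ 25) :
    ∃ m : ℕ, m ≤ 1024 ∧
      (1024 * (((29 + d).choose 5 : ℚ) +
      (∑ j ∈ Finset.range (d - 5), (Nat.choose (min 13 ((d + 6) / 2 + 1 - 2)) j : ℚ) / (((j + 1) + 3 * (j + 1).choose 2 : ℕ) : ℚ)) *
        ((d * (d + 1) / 2 * (29 + d).choose 3 + d * (d + 1) * (d + 2) / 3 * (29 + d).choose 2 + (d + 4).choose 5 * (29 + d) + (d + 5).choose 6 : ℕ) : ℚ) +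
      ((∑ j ∈ Finset.range (d - 5), (Nat.choose (min 19 (5 + d) - 6) j : ℚ) / (((j + 1) + 3 * (j + 1).choose 2 : ℕ) : ℚ)) -
        (∑ j ∈ Finset.range (d - 5), (Nat.choose (min 5 (d - 1)) j : ℚ) / (((j + 1) + 3 * (j + 1).choose 2 : ℕ) : ℚ))) *
        ((d * (d + 1) / 2 * (min 19 (5 + d)).choose 3 + d * (d + 1) * (d + 2) / 3 * (min 19 (5 + d)).choose 2 + (d + 4).choose 5 * (min 19 (5 + d)) + (d + 5).choose 6 : ℕ) : ℚ)) ≤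
        ((1024 - m : ℕ) : ℚ) * 2 ^ (d - 5) * ((29 + 5).choose 5 : ℚ)) ∧
      (1024 * ((((29 + d).choose 4 * 2 ^ 6 + (29 + d).choose 3 * 2 ^ 3 + (29 + d).choose 2 * 2 + (29 + d) + 1 : ℕ) : ℚ) +
      (((29 + d).choose 5 : ℚ) + (∑ j ∈ Finset.range (d), (Nat.choose (min 13 ((d + 6) / 2 + 1 - 2)) j : ℚ) / (((j + 1) + 3 * (j + 1).choose 2 : ℕ) : ℚ)) * ((d * (d + 1) / 2 * (29 + d).choose 3 + d * (d + 1) * (d + 2) / 3 * (29 + d).choose 2 + (d + 4).choose 5 * (29 + d) + (d + 5).choose 6 : ℕ) : ℚ) +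
        ((∑ j ∈ Finset.range (d), (Nat.choose (min 19 (5 + d) - 6) j : ℚ) / (((j + 1) + 3 * (j + 1).choose 2 : ℕ) : ℚ)) - (∑ j ∈ Finset.range (d), (Nat.choose (min 5 (d - 1)) j : ℚ) / (((j + 1) + 3 * (j + 1).choose 2 : ℕ) : ℚ))) * ((d * (d + 1) / 2 * (min 19 (5 + d)).choose 3 + d * (d + 1) * (d + 2) / 3 * (min 19 (5 + d)).choose 2 + (d + 4).choose 5 * (min 19 (5 + d)) + (d + 5).choose 6 : ℕ) : ℚ)) +
      ((∑ j ∈ Finset.range (d + 1), (29 + d).choose j : ℕ) : ℚ)) ≤ (m : ℚ) * 2 ^ (29 + d)) := by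
  interval_cases d
  · exact ⟨1, by norm_num, cell29_poly_6, cell29_tail_6⟩
  · exact ⟨1, by norm_num, cell29_poly_7, cell29_tail_7⟩
  · exact ⟨1, by norm_num, cell29_poly_8, cell29_tail_8⟩
  · exact ⟨1, by norm_num, cell29_poly_9, cell29_tail_9⟩
  · exact ⟨2, by norm_num, cell29_poly_10, cell29_tail_10⟩
  · exact ⟨4, by norm_num, cell29_poly_11, cell29_tail_11⟩
  · exact ⟨6, by norm_num, cell29_poly_12, cell29_tail_12⟩
  · exact ⟨11, by norm_num, cell29_poly_13, cell29_tail_13⟩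
  · exact ⟨17, by norm_num, cell29_poly_14, cell29_tail_14⟩
  · exact ⟨25, by norm_num, cell29_poly_15, cell29_tail_15⟩
  · exact ⟨38, by norm_num, cell29_poly_16, cell29_tail_16⟩
  · exact ⟨54, by norm_num, cell29_poly_17, cell29_tail_17⟩
  · exact ⟨74, by norm_num, cell29_poly_18, cell29_tail_18⟩
  · exact ⟨100, by norm_num, cell29_poly_19, cell29_tail_19⟩
  · exact ⟨130, by norm_num, cell29_poly_20, cell29_tail_20⟩
  · exact ⟨165, by norm_num, cell29_poly_21, cell29_tail_21⟩
  · exact ⟨206, by norm_num, cell29_poly_22, cell29_tail_22⟩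
  · exact ⟨251, by norm_num, cell29_poly_23, cell29_tail_23⟩
  · exact ⟨299, by norm_num, cell29_poly_24, cell29_tail_24⟩
  · exact ⟨350, by norm_num, cell29_poly_25, cell29_tail_25⟩

end S2

namespace ThmN

open Set

variable {α : Type}

/-- **The `e`-free core at level `5`, corank `6 ≤ d ≤ 25`, rank `p = 29`** (the «31» chain's matroid part verbatim; the
twenty cells `(29, d)` with the free slack `m_d/1024`). -/
theorem c025_core_five_bounded_corank_three29 (M : Matroid α) [M.Finite] (p d : ℕ) (hp : p = 29) (hd6 : 6 ≤ d)
    (hd25 : d ≤ 25) (hR : M.eRank = (p : ℕ∞)) (hn : M.E.ncard = p + d)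
    (hfree : ∀ e ∈ M.E, ∃ A ⊆ M.E \ {e}, e ∉ M.closure A ∧ e ∉ M.closure ((M.E \ {e}) \ A)) :
    RLS M p 5 := by
  classical
  have hEcard : M.ground_finite.toFinset.card = p + d := by
    rw [← Set.ncard_eq_toFinset_card _ M.ground_finite]; exact hn
  -- the core is simple: every circuit has `≥ 3` elements
  have hL0 : ∀ e ∈ M.E, ¬ M.IsLoop e := not_isLoop_of_free M hfree
  have hs : ∀ e ∈ M.E, ∀ f ∈ M.E, e ≠ f → M.eRk {e, f} = 2 := by
    intro e he f hf hef
    have h2 : (2 : ℕ∞) ≤ M.eRk {e, f} :=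
      two_le_eRk_of_two_le_ncard_of_free M hfree (pair_subset he hf) (by rw [ncard_pair hef])
    have h3 : M.eRk {e, f} ≤ 2 := by
      have := M.eRk_le_encard {e, f}
      rwa [encard_pair hef] at this
    exact le_antisymm h3 h2
  have hcirc : ∀ C, M.IsCircuit C → 3 ≤ C.encard := three_le_encard_of_circuit M hL0 hs
  have hd : M.E.encard = M.eRank + d := by
    rw [hR, ← M.ground_finite.cast_ncard_eq, hn]
    push_cast
    ring
  -- the capped flat bounds: rank-`≤ 5` sets have `≤ min 19 (5 + d)` points, rank-`≤ 4` sets `≤ min 10 (4 + d)`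
  have hflat : ∀ X ⊆ M.E, M.eRk X ≤ 5 → X.ncard ≤ min 19 (5 + d) := fun X hX hr =>
    le_min (ncard_le_nineteen_of_eRk_le_five_of_free M hfree hX hr)
      (ncard_le_add_of_eRk_le_of_encard_eq M hd hX hr)
  have hflat' : ∀ X ⊆ M.E, M.eRk X ≤ ((5 - 1 : ℕ) : ℕ∞) → X.ncard ≤ min 10 (4 + d) := fun X hX hr =>
    le_min (ncard_le_ten_of_eRk_le_four_of_free M hfree hX (by simpa using hr))
      (ncard_le_add_of_eRk_le_of_encard_eq M hd hX (by simpa using hr))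
  -- the circuit counts: Lemma T, Lemma T4, and the nullity bounds
  have hC1 : ∀ L ⊆ M.E, M.eRk L = 2 → L.ncard ≤ 3 :=
    fun L hL hr => ncard_le_three_of_eRk_two M hs hfree hL hr
  have hC1' : ∀ L ⊆ M.E, M.eRk L ≤ 2 → L.ncard ≤ 3 := fun L hL hr => by
    have := ncard_add_one_le_two_pow_of_eRk_le M hL0 hfree 2 L hL hr
    omega
  have hC2 : ∀ P ⊆ M.E, M.eRk P ≤ 3 → P.ncard ≤ 6 :=
    fun P hP hr => ncard_le_six_of_eRk_le_three_of_free M hfree hP hr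
  have hs3 : {C | M.IsCircuit C ∧ C.ncard = 3}.ncard ≤ d * (d + 1) / 2 := by
    have := S1.two_mul_ncard_triangles_le M hC1 hd
    unfold triangles at this
    omega
  have hs4 : {C | M.IsCircuit C ∧ C.ncard = 4}.ncard ≤ d * (d + 1) * (d + 2) / 3 := by
    have := S1.three_mul_ncard_four_circuits_le M hC1' hC2 hd
    omega
  have hs5 : {C | M.IsCircuit C ∧ C.ncard = 5}.ncard ≤ (d + 4).choose 5 :=
    Matroid.ncard_circuits_le_choose_of_encard M hd 4
  have hs6 : {C | M.IsCircuit C ∧ C.ncard = 6}.ncard ≤ (d + 5).choose 6 :=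
    Matroid.ncard_circuits_le_choose_of_encard M hd 5
  -- (U): the square-multiplicity count in the PARTITION form, in `ℚ`, then the circuit bounds
  set ν₁ : ℕ := (d + 6) / 2 + 1 with hν₁
  have hU0 := S2.ncard_eRk_eq_ncard_le_le_giant_three' M 5 (min 19 (5 + d)) (min 10 (4 + d)) ν₁ 6 (by norm_num)
    hcirc hC1 hflat hflat' (hinter_five M hfree) hd (by omega) (by omega) (by omega)
  have hU1 := Matroid.topCount_le_ncard_compl (M := M) hR hd 5
  have hm1 : min (min 19 (5 + d) - 6) (ν₁ - 2) = min 13 ((d + 6) / 2 + 1 - 2) := by omega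
  have hm2 : min 10 (4 + d) - 5 = min 5 (d - 1) := by omega
  have hm3 : min (min 19 (5 + d)) (5 + d) = min 19 (5 + d) := by omega
  simp only [show (5 : ℕ) + 1 = 6 from rfl] at hU0
  rw [hn, sum_Icc_three_six_q, sum_Icc_three_six_q, hm1, hm2, hm3,
    show d - 6 + 1 = d - 5 by omega] at hU0
  simp only [show (6 : ℕ) - 3 = 3 from rfl, show (6 : ℕ) - 4 = 2 from rfl,
    show (6 : ℕ) - 5 = 1 from rfl, show (6 : ℕ) - 6 = 0 from rfl, Nat.choose_one_right,
    Nat.choose_zero_right] at hU0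
  have hUq : (Matroid.topCount M p 5 : ℚ) ≤ ((p + d).choose 5 : ℚ) +
      (∑ j ∈ Finset.range (d - 5), (Nat.choose (min 13 ((d + 6) / 2 + 1 - 2)) j : ℚ) / (((j + 1) + 3 * (j + 1).choose 2 : ℕ) : ℚ)) *
        ((d * (d + 1) / 2 * (p + d).choose 3 + d * (d + 1) * (d + 2) / 3 * (p + d).choose 2 +
          (d + 4).choose 5 * (p + d) + (d + 5).choose 6 : ℕ) : ℚ) +
      ((∑ j ∈ Finset.range (d - 5), (Nat.choose (min 19 (5 + d) - 6) j : ℚ) / (((j + 1) + 3 * (j + 1).choose 2 : ℕ) : ℚ)) -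
        (∑ j ∈ Finset.range (d - 5), (Nat.choose (min 5 (d - 1)) j : ℚ) / (((j + 1) + 3 * (j + 1).choose 2 : ℕ) : ℚ))) *
        ((d * (d + 1) / 2 * (min 19 (5 + d)).choose 3 + d * (d + 1) * (d + 2) / 3 * (min 19 (5 + d)).choose 2 +
          (d + 4).choose 5 * (min 19 (5 + d)) + (d + 5).choose 6 : ℕ) : ℚ) := by
    have hU1q : (Matroid.topCount M p 5 : ℚ) ≤
        ({B : Set α | B ⊆ M.E ∧ M.eRk B = 5 ∧ B.ncard ≤ d}.ncard : ℚ) := by exact_mod_cast hU1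
    have hsm : {C | M.IsCircuit C ∧ C.ncard = 3}.ncard * (p + d).choose 3 +
        {C | M.IsCircuit C ∧ C.ncard = 4}.ncard * (p + d).choose 2 +
        {C | M.IsCircuit C ∧ C.ncard = 5}.ncard * (p + d) + {C | M.IsCircuit C ∧ C.ncard = 6}.ncard * 1 ≤
        d * (d + 1) / 2 * (p + d).choose 3 + d * (d + 1) * (d + 2) / 3 * (p + d).choose 2 +
          (d + 4).choose 5 * (p + d) + (d + 5).choose 6 := by
      have := hs6
      gcongr
      omega
    have hgg : {C | M.IsCircuit C ∧ C.ncard = 3}.ncard * (min 19 (5 + d)).choose 3 +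
        {C | M.IsCircuit C ∧ C.ncard = 4}.ncard * (min 19 (5 + d)).choose 2 +
        {C | M.IsCircuit C ∧ C.ncard = 5}.ncard * (min 19 (5 + d)) + {C | M.IsCircuit C ∧ C.ncard = 6}.ncard * 1 ≤
        d * (d + 1) / 2 * (min 19 (5 + d)).choose 3 + d * (d + 1) * (d + 2) / 3 * (min 19 (5 + d)).choose 2 +
          (d + 4).choose 5 * (min 19 (5 + d)) + (d + 5).choose 6 := by
      gcongr
      omega
    have hsmq : (({C | M.IsCircuit C ∧ C.ncard = 3}.ncard : ℚ) * ((p + d).choose 3 : ℚ) +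
        ({C | M.IsCircuit C ∧ C.ncard = 4}.ncard : ℚ) * ((p + d).choose 2 : ℚ) +
        ({C | M.IsCircuit C ∧ C.ncard = 5}.ncard : ℚ) * ((p + d : ℕ) : ℚ) +
        ({C | M.IsCircuit C ∧ C.ncard = 6}.ncard : ℚ) * ((1 : ℕ) : ℚ)) ≤
        ((d * (d + 1) / 2 * (p + d).choose 3 + d * (d + 1) * (d + 2) / 3 * (p + d).choose 2 +
          (d + 4).choose 5 * (p + d) + (d + 5).choose 6 : ℕ) : ℚ) := by exact_mod_cast hsm
    have hggq : (({C | M.IsCircuit C ∧ C.ncard = 3}.ncard : ℚ) * ((min 19 (5 + d)).choose 3 : ℚ) +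
        ({C | M.IsCircuit C ∧ C.ncard = 4}.ncard : ℚ) * ((min 19 (5 + d)).choose 2 : ℚ) +
        ({C | M.IsCircuit C ∧ C.ncard = 5}.ncard : ℚ) * ((min 19 (5 + d) : ℕ) : ℚ) +
        ({C | M.IsCircuit C ∧ C.ncard = 6}.ncard : ℚ) * ((1 : ℕ) : ℚ)) ≤
        ((d * (d + 1) / 2 * (min 19 (5 + d)).choose 3 + d * (d + 1) * (d + 2) / 3 * (min 19 (5 + d)).choose 2 +
          (d + 4).choose 5 * (min 19 (5 + d)) + (d + 5).choose 6 : ℕ) : ℚ) := by exact_mod_cast hgg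
    -- `σ_s ≤ σ_g` (termwise), so the giant excess is non-negative
    have hσ : (∑ j ∈ Finset.range (d - 5), (Nat.choose (min 5 (d - 1)) j : ℚ) / (((j + 1) + 3 * (j + 1).choose 2 : ℕ) : ℚ)) ≤
        ∑ j ∈ Finset.range (d - 5), (Nat.choose (min 19 (5 + d) - 6) j : ℚ) / (((j + 1) + 3 * (j + 1).choose 2 : ℕ) : ℚ) := by
      apply Finset.sum_le_sum
      intro j _
      have : (min 5 (d - 1)).choose j ≤ (min 19 (5 + d) - 6).choose j := Nat.choose_le_choose j (by omega)
      have h' : ((min 5 (d - 1)).choose j : ℚ) ≤ ((min 19 (5 + d) - 6).choose j : ℚ) := by exact_mod_cast this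
      exact div_le_div_of_nonneg_right h' (by positivity)
    have hσm0 : (0 : ℚ) ≤ ∑ j ∈ Finset.range (d - 5), (Nat.choose (min 13 ((d + 6) / 2 + 1 - 2)) j : ℚ) / (((j + 1) + 3 * (j + 1).choose 2 : ℕ) : ℚ) :=
      Finset.sum_nonneg (fun j _ => by positivity)
    refine hU1q.trans (hU0.trans ?_)
    have e1 := mul_le_mul_of_nonneg_left hsmq hσm0
    have e2 := mul_le_mul_of_nonneg_left hggq (by linarith : (0 : ℚ) ≤
      (∑ j ∈ Finset.range (d - 5), (Nat.choose (min 19 (5 + d) - 6) j : ℚ) / (((j + 1) + 3 * (j + 1).choose 2 : ℕ) : ℚ)) -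
        (∑ j ∈ Finset.range (d - 5), (Nat.choose (min 5 (d - 1)) j : ℚ) / (((j + 1) + 3 * (j + 1).choose 2 : ℕ) : ℚ)))
    linarith
  -- (Y): the STRUCTURED flat tail — ranks `≤ 4` through their closures, rank `5` by the level count at `D = 5 + d`
  have hY := Matroid.two_pow_le_midCount_add (M := M) p 5 hR
  have hsum5 := S2.ncard_eRk_le_le_sum M 5
  simp only [Finset.sum_range_succ, Finset.sum_range_zero, zero_add] at hsum5
  have h4 : {X : Set α | X ⊆ M.E ∧ M.eRk X = (4 : ℕ)}.ncard ≤ M.E.ncard.choose 4 * 2 ^ (10 - 4) :=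
    S2.ncard_eRk_eq_le_choose_mul_two_pow M 4 10
      (fun X hX hr => ncard_le_ten_of_eRk_le_four_of_free M hfree hX (by exact_mod_cast hr))
  have h3 : {X : Set α | X ⊆ M.E ∧ M.eRk X = (3 : ℕ)}.ncard ≤ M.E.ncard.choose 3 * 2 ^ (6 - 3) :=
    S2.ncard_eRk_eq_le_choose_mul_two_pow M 3 6
      (fun X hX hr => ncard_le_six_of_eRk_le_three_of_free M hfree hX (by exact_mod_cast hr))
  have h2 : {X : Set α | X ⊆ M.E ∧ M.eRk X = (2 : ℕ)}.ncard ≤ M.E.ncard.choose 2 * 2 ^ (3 - 2) :=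
    S2.ncard_eRk_eq_le_choose_mul_two_pow M 2 3
      (fun X hX hr => by
        have := ncard_add_one_le_two_pow_of_eRk_le M hL0 hfree 2 X hX hr
        omega)
  have h1 : {X : Set α | X ⊆ M.E ∧ M.eRk X = (1 : ℕ)}.ncard ≤ M.E.ncard.choose 1 * 2 ^ (1 - 1) :=
    S2.ncard_eRk_eq_le_choose_mul_two_pow M 1 1
      (fun X hX hr => by
        have := ncard_add_one_le_two_pow_of_eRk_le M hL0 hfree 1 X hX hr
        omega)
  have h0 : {X : Set α | X ⊆ M.E ∧ M.eRk X = (0 : ℕ)}.ncard ≤ M.E.ncard.choose 0 * 2 ^ (0 - 0) :=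
    S2.ncard_eRk_eq_le_choose_mul_two_pow M 0 0
      (fun X hX hr => by
        have := ncard_add_one_le_two_pow_of_eRk_le M hL0 hfree 0 X hX hr
        omega)
  -- the rank-`5` sets have `≤ 5 + d` points (the nullity cap)
  have h5 : {X : Set α | X ⊆ M.E ∧ M.eRk X = 5}.ncard ≤
      {B : Set α | B ⊆ M.E ∧ M.eRk B = 5 ∧ B.ncard ≤ 5 + d}.ncard := by
    apply Set.ncard_le_ncard
    · intro X hX
      exact ⟨hX.1, hX.2, ncard_le_add_of_eRk_le_of_encard_eq M hd hX.1 (le_of_eq hX.2)⟩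
    · exact M.ground_finite.finite_subsets.subset (fun B hB => hB.1)
  have hD0 := S2.ncard_eRk_eq_ncard_le_le_giant_three_D M 5 (min 19 (5 + d)) (min 10 (4 + d)) ν₁ 6 (5 + d)
    (by norm_num) hcirc hC1 hflat hflat' (hinter_five M hfree) hd (by omega) (by omega) (by omega)
  simp only [show (5 : ℕ) + 1 = 6 from rfl] at hD0
  rw [hn, sum_Icc_three_six_q, sum_Icc_three_six_q, hm1, hm2, hm3,
    show 5 + d - 6 + 1 = d by omega] at hD0
  simp only [show (6 : ℕ) - 3 = 3 from rfl, show (6 : ℕ) - 4 = 2 from rfl,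
    show (6 : ℕ) - 5 = 1 from rfl, show (6 : ℕ) - 6 = 0 from rfl, Nat.choose_one_right,
    Nat.choose_zero_right] at hD0
  have hDq : ({B : Set α | B ⊆ M.E ∧ M.eRk B = 5 ∧ B.ncard ≤ 5 + d}.ncard : ℚ) ≤ ((p + d).choose 5 : ℚ) +
      (∑ j ∈ Finset.range (d), (Nat.choose (min 13 ((d + 6) / 2 + 1 - 2)) j : ℚ) / (((j + 1) + 3 * (j + 1).choose 2 : ℕ) : ℚ)) *
        ((d * (d + 1) / 2 * (p + d).choose 3 + d * (d + 1) * (d + 2) / 3 * (p + d).choose 2 +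
          (d + 4).choose 5 * (p + d) + (d + 5).choose 6 : ℕ) : ℚ) +
      ((∑ j ∈ Finset.range (d), (Nat.choose (min 19 (5 + d) - 6) j : ℚ) / (((j + 1) + 3 * (j + 1).choose 2 : ℕ) : ℚ)) -
        (∑ j ∈ Finset.range (d), (Nat.choose (min 5 (d - 1)) j : ℚ) / (((j + 1) + 3 * (j + 1).choose 2 : ℕ) : ℚ))) *
        ((d * (d + 1) / 2 * (min 19 (5 + d)).choose 3 + d * (d + 1) * (d + 2) / 3 * (min 19 (5 + d)).choose 2 +
          (d + 4).choose 5 * (min 19 (5 + d)) + (d + 5).choose 6 : ℕ) : ℚ) := by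
    have hsm : {C | M.IsCircuit C ∧ C.ncard = 3}.ncard * (p + d).choose 3 +
        {C | M.IsCircuit C ∧ C.ncard = 4}.ncard * (p + d).choose 2 +
        {C | M.IsCircuit C ∧ C.ncard = 5}.ncard * (p + d) + {C | M.IsCircuit C ∧ C.ncard = 6}.ncard * 1 ≤
        d * (d + 1) / 2 * (p + d).choose 3 + d * (d + 1) * (d + 2) / 3 * (p + d).choose 2 +
          (d + 4).choose 5 * (p + d) + (d + 5).choose 6 := by
      have := hs6
      gcongr
      omega
    have hgg : {C | M.IsCircuit C ∧ C.ncard = 3}.ncard * (min 19 (5 + d)).choose 3 +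
        {C | M.IsCircuit C ∧ C.ncard = 4}.ncard * (min 19 (5 + d)).choose 2 +
        {C | M.IsCircuit C ∧ C.ncard = 5}.ncard * (min 19 (5 + d)) + {C | M.IsCircuit C ∧ C.ncard = 6}.ncard * 1 ≤
        d * (d + 1) / 2 * (min 19 (5 + d)).choose 3 + d * (d + 1) * (d + 2) / 3 * (min 19 (5 + d)).choose 2 +
          (d + 4).choose 5 * (min 19 (5 + d)) + (d + 5).choose 6 := by
      gcongr
      omega
    have hsmq : (({C | M.IsCircuit C ∧ C.ncard = 3}.ncard : ℚ) * ((p + d).choose 3 : ℚ) +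
        ({C | M.IsCircuit C ∧ C.ncard = 4}.ncard : ℚ) * ((p + d).choose 2 : ℚ) +
        ({C | M.IsCircuit C ∧ C.ncard = 5}.ncard : ℚ) * ((p + d : ℕ) : ℚ) +
        ({C | M.IsCircuit C ∧ C.ncard = 6}.ncard : ℚ) * ((1 : ℕ) : ℚ)) ≤
        ((d * (d + 1) / 2 * (p + d).choose 3 + d * (d + 1) * (d + 2) / 3 * (p + d).choose 2 +
          (d + 4).choose 5 * (p + d) + (d + 5).choose 6 : ℕ) : ℚ) := by exact_mod_cast hsm
    have hggq : (({C | M.IsCircuit C ∧ C.ncard = 3}.ncard : ℚ) * ((min 19 (5 + d)).choose 3 : ℚ) +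
        ({C | M.IsCircuit C ∧ C.ncard = 4}.ncard : ℚ) * ((min 19 (5 + d)).choose 2 : ℚ) +
        ({C | M.IsCircuit C ∧ C.ncard = 5}.ncard : ℚ) * ((min 19 (5 + d) : ℕ) : ℚ) +
        ({C | M.IsCircuit C ∧ C.ncard = 6}.ncard : ℚ) * ((1 : ℕ) : ℚ)) ≤
        ((d * (d + 1) / 2 * (min 19 (5 + d)).choose 3 + d * (d + 1) * (d + 2) / 3 * (min 19 (5 + d)).choose 2 +
          (d + 4).choose 5 * (min 19 (5 + d)) + (d + 5).choose 6 : ℕ) : ℚ) := by exact_mod_cast hgg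
    have hσ : (∑ j ∈ Finset.range (d), (Nat.choose (min 5 (d - 1)) j : ℚ) / (((j + 1) + 3 * (j + 1).choose 2 : ℕ) : ℚ)) ≤
        ∑ j ∈ Finset.range (d), (Nat.choose (min 19 (5 + d) - 6) j : ℚ) / (((j + 1) + 3 * (j + 1).choose 2 : ℕ) : ℚ) := by
      apply Finset.sum_le_sum
      intro j _
      have : (min 5 (d - 1)).choose j ≤ (min 19 (5 + d) - 6).choose j := Nat.choose_le_choose j (by omega)
      have h' : ((min 5 (d - 1)).choose j : ℚ) ≤ ((min 19 (5 + d) - 6).choose j : ℚ) := by exact_mod_cast this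
      exact div_le_div_of_nonneg_right h' (by positivity)
    have hσm0 : (0 : ℚ) ≤ ∑ j ∈ Finset.range (d), (Nat.choose (min 13 ((d + 6) / 2 + 1 - 2)) j : ℚ) / (((j + 1) + 3 * (j + 1).choose 2 : ℕ) : ℚ) :=
      Finset.sum_nonneg (fun j _ => by positivity)
    refine hD0.trans ?_
    have e1 := mul_le_mul_of_nonneg_left hsmq hσm0
    have e2 := mul_le_mul_of_nonneg_left hggq (by linarith : (0 : ℚ) ≤
      (∑ j ∈ Finset.range (d), (Nat.choose (min 19 (5 + d) - 6) j : ℚ) / (((j + 1) + 3 * (j + 1).choose 2 : ℕ) : ℚ)) -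
        (∑ j ∈ Finset.range (d), (Nat.choose (min 5 (d - 1)) j : ℚ) / (((j + 1) + 3 * (j + 1).choose 2 : ℕ) : ℚ)))
    linarith
  have hB := Matroid.ncard_spanning_le (M := M) hd
  rw [hEcard] at hY hB
  have hΦ := phiK_le_two_pow_div p 5
  rw [Nat.choose_symm_add] at hΦ
  rw [add_assoc] at hUq
  rw [RLS_iff]
  have hYq : (2 : ℚ) ^ (p + d) ≤ (Matroid.midCount M p 5 : ℚ) +
      ({X : Set α | X ⊆ M.E ∧ M.eRk X ≤ 5}.ncard : ℚ) +
      ({X : Set α | X ⊆ M.E ∧ M.eRk X = M.eRank}.ncard : ℚ) := by exact_mod_cast hY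
  have hU0' : (0 : ℚ) ≤ (Matroid.topCount M p 5 : ℚ) := Nat.cast_nonneg _
  have hd5 : 5 ≤ d := by omega
  -- `#{r ≤ 5} ≤ F₄(n) + count₅` in `ℚ`
  norm_num [Nat.choose_one_right] at h4 h3 h2 h1 h0
  rw [hn] at h4 h3 h2 h1
  have hAq : ({X : Set α | X ⊆ M.E ∧ M.eRk X ≤ 5}.ncard : ℚ) ≤
      (((p + d).choose 4 * 2 ^ 6 + (p + d).choose 3 * 2 ^ 3 + (p + d).choose 2 * 2 + (p + d) + 1 : ℕ) : ℚ) +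
      (((p + d).choose 5 : ℚ) +
        (∑ j ∈ Finset.range (d), (Nat.choose (min 13 ((d + 6) / 2 + 1 - 2)) j : ℚ) / (((j + 1) + 3 * (j + 1).choose 2 : ℕ) : ℚ)) *
          ((d * (d + 1) / 2 * (p + d).choose 3 + d * (d + 1) * (d + 2) / 3 * (p + d).choose 2 +
            (d + 4).choose 5 * (p + d) + (d + 5).choose 6 : ℕ) : ℚ) +
        ((∑ j ∈ Finset.range (d), (Nat.choose (min 19 (5 + d) - 6) j : ℚ) / (((j + 1) + 3 * (j + 1).choose 2 : ℕ) : ℚ)) -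
          (∑ j ∈ Finset.range (d), (Nat.choose (min 5 (d - 1)) j : ℚ) / (((j + 1) + 3 * (j + 1).choose 2 : ℕ) : ℚ))) *
          ((d * (d + 1) / 2 * (min 19 (5 + d)).choose 3 + d * (d + 1) * (d + 2) / 3 * (min 19 (5 + d)).choose 2 +
            (d + 4).choose 5 * (min 19 (5 + d)) + (d + 5).choose 6 : ℕ) : ℚ)) := by
    have hA4 : {X : Set α | X ⊆ M.E ∧ M.eRk X ≤ 5}.ncard ≤
        ((p + d).choose 4 * 2 ^ 6 + (p + d).choose 3 * 2 ^ 3 + (p + d).choose 2 * 2 + (p + d) + 1) +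
        {B : Set α | B ⊆ M.E ∧ M.eRk B = 5 ∧ B.ncard ≤ 5 + d}.ncard := by
      push_cast at hsum5
      omega
    have hA4q : ({X : Set α | X ⊆ M.E ∧ M.eRk X ≤ 5}.ncard : ℚ) ≤
        (((p + d).choose 4 * 2 ^ 6 + (p + d).choose 3 * 2 ^ 3 + (p + d).choose 2 * 2 + (p + d) + 1 : ℕ) : ℚ) +
        ({B : Set α | B ⊆ M.E ∧ M.eRk B = 5 ∧ B.ncard ≤ 5 + d}.ncard : ℚ) := by exact_mod_cast hA4
    exact hA4q.trans (add_le_add le_rfl hDq)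
  have hBq : ({X : Set α | X ⊆ M.E ∧ M.eRk X = M.eRank}.ncard : ℚ) ≤
      ((∑ j ∈ Finset.range (d + 1), (p + d).choose j : ℕ) : ℚ) := by exact_mod_cast hB
  subst hp
  obtain ⟨m, hm, hpoly29, htail29⟩ := S2.cells29 d hd6 hd25
  have hABq : (1024 : ℚ) * (({X : Set α | X ⊆ M.E ∧ M.eRk X ≤ 5}.ncard : ℚ) +
      ({X : Set α | X ⊆ M.E ∧ M.eRk X = M.eRank}.ncard : ℚ)) ≤ (m : ℚ) * 2 ^ (29 + d) := by linarith
  rw [add_assoc] at hpoly29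
  exact S2.level_arith_slack (p := 29) (d := d) (n := 29 + d) (q := 5) rfl hd5 hΦ hU0' hUq hYq (k := 1024) (m := m)
    (by norm_num) hm hABq hpoly29

/-- **THEOREM C₅, GIVEN LEVEL `4` FROM `P ≥ 29`**: level `4` for all `p ≥ P` implies level `5` for all `p ≥ P + 1`
(coranks `6 … 25` by the cells at `p = 29` or `p ≥ 30`, `≥ 26` by `c025_core_five_nineteen`). -/
theorem c025_five_of_four_three_from29 (P : ℕ) (hP : 29 ≤ P)
    (h4 : ∀ (M : Matroid α) [M.Finite] (p : ℕ), P ≤ p → RLS M p 4) :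
    ∀ (M : Matroid α) [M.Finite] (p : ℕ), P + 1 ≤ p → RLS M p 5 := by
  refine S2.rls_five_of_four_of_core P (by omega) h4 ?_
  intro M _ p hP' hR hbig hfree
  rcases Nat.lt_or_ge M.E.ncard (p + 26) with h | h
  · rcases Nat.lt_or_ge p 30 with h29 | h30
    · exact c025_core_five_bounded_corank_three29 M p (M.E.ncard - p) (by omega) (by omega) (by omega) hR (by omega) hfree
    · exact c025_core_five_bounded_corank_three M p (M.E.ncard - p) h30 (by omega) (by omega) hR (by omega) hfree
  · exact c025_core_five_nineteen M p (by omega) hR (by omega) hfree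

/-- **THEOREM C₅ AT `30`, UNCONDITIONAL**: every finite matroid satisfies C-025 at level `5` for every `p ≥ 30` (level
`4` from S1's `c025_four_twentyseven`). -/
theorem c025_five_large_three30 (M : Matroid α) [M.Finite] (p : ℕ) (hp : 30 ≤ p) : RLS M p 5 :=
  c025_five_of_four_three_from29 29 le_rfl (fun M _ p hp => S1.c025_four_twentyseven M p (by omega)) M p hp

/-- The level-`5` statement at `p ≥ 30` in the vocabulary of `C025`. -/
theorem c025_five_large_three30' (M : Matroid α) [M.Finite] (p : ℕ) (hp : 30 ≤ p) :
    phiK p 5 * ({A : Set α | A ⊆ M.E ∧ M.eRk A = (p : ℕ∞) ∧ M.eRk (M.E \ A) = (5 : ℕ∞)}.ncard : ℚ) ≤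
      ({A : Set α | A ⊆ M.E ∧ (5 : ℕ∞) < M.eRk A ∧ M.eRk A < (p : ℕ∞)}.ncard : ℚ) :=
  c025_five_large_three30 M p hp

end ThmN

end PercRepro
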